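import Literature.Combinatorics.Designs.ProjectivePlaneOrder12Collineations

/-!
# PP(12): the printed floor on collineation groups, as one statement (cell pub-namedobj, target M, family B1)
Framing: lottery ticket; floor = certified bounds/negative ranges.

From the named facts [AST 2019, Corollary] (`G` cyclic, `|G| ∣ 3` or `|G| ∣ 4`) and [AST 2023]
(`|G| ≠ 4`) we derive the sentence the census uses to decide which structured cases of family B1 are
still open: **a collineation group of a projective plane of order 12 has order 1, 2 or 3** — so the
only assumed-symmetry cells not excluded in print are a single involution (an elation, since 12 is not
a square) and a single collineation of order 3 (not an elation, by Janko–van Trung). CONDITIONAL on the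
two facts (hypotheses `h19`, `h23`); nothing else is assumed.
-/

namespace Summit.Ventures.DiscreteObjects.PP12

open Configuration Literature.Combinatorics.Designs

/-- A natural number dividing `4` other than `4` is `1` or `2`. -/
theorem eq_one_or_two_of_dvd_four {m : ℕ} (h : m ∣ 4) (h4 : m ≠ 4) : m = 1 ∨ m = 2 := by
  have hle : m ≤ 4 := Nat.le_of_dvd (by norm_num) h
  interval_cases m <;> simp_all

/-- A natural number dividing `3` is `1` or `3`. -/
theorem eq_one_or_three_of_dvd_three {m : ℕ} (h : m ∣ 3) : m = 1 ∨ m = 3 :=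
  (Nat.dvd_prime Nat.prime_three).mp h

/-- **The printed floor for family B1.** Given [AST 2019, Corollary] and [AST 2023], every
collineation group `G` of a projective plane of order 12 (a finite group acting on points and lines,
faithfully on points, preserving incidence) has order `1`, `2` or `3`. -/
theorem card_collineationGroup_le_three (h19 : CollineationGroupCyclicOrderDvd)
    (h23 : NoCollineationGroupOfOrderFour)
    (P L : Type) [Membership P L] [Fintype P] [Fintype L] [ProjectivePlane P L]
    (h12 : ProjectivePlane.order P L = 12)
    (G : Type) [Group G] [Fintype G] [MulAction G P] [MulAction G L]
    (hG : IsCollineationGroup G P L) :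
    Fintype.card G = 1 ∨ Fintype.card G = 2 ∨ Fintype.card G = 3 := by
  obtain ⟨-, h3 | h4⟩ := h19 P L h12 G hG
  · rcases eq_one_or_three_of_dvd_three h3 with h | h
    · exact Or.inl h
    · exact Or.inr (Or.inr h)
  · rcases eq_one_or_two_of_dvd_four h4 (h23 P L h12 G hG) with h | h
    · exact Or.inl h
    · exact Or.inr (Or.inl h)

end Summit.Ventures.DiscreteObjects.PP12
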